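import Literature.Probability.Percolation.OneArmPivotalLayerSub
import HarnessLib

/-!
# Nolin's Thm. 27 (`j = 1`) from four named facts: the critical half-plane two-arm leaf removed (proofs only)

Topic `Literature/Probability/Percolation`; family `crit-perc`. PROOFS ONLY: no new definition, no
new named fact. Sequel of `OneArmPivotalLayerSub.lean` for the named fact `Nolin2008_thm27_oneArm`
(`NearCriticalScaling.lean`; Nolin 2008, §6.1, Thm. 27 [arXiv 0711.4948: Thm. 26], `j = 1`:
`c π₁(N) ≤ P_p(0 ↔ ∂Λ_N) ≤ C π₁(N)` for `p ≠ 1/2` near `1/2`, `N ≤ L_ε(p)`, every `ε ∈ (0, 1/2)`).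

## What changed

The tree's `Nolin2008_thm27_oneArm_of_facts` (`OneArmPivotalLayerSub.lean`) derives Nolin's
theorem from FIVE named facts of Kesten's near-critical theory: `Werner2009_fourArm_quasiMult`,
`Werner2009_fourArm_lowerBound`, `Nolin2008_halfPlane_twoArm`, `Werner2009_halfPlane_twoArm`,
`Werner2009_pivotal_lowerBound`. The critical half-plane two-arm bound `Nolin2008_halfPlane_twoArm`
(Nolin 2008, Thm. 24 (i), for EVERY colour pair, in particular two closed arms — the monochromatic
case resting on the colour-switching argument of §4.6) entered only through the super-critical half,
taken there from `Werner2009_oneArm_nearCritical_of_facts` (`ParaPivotalSumBounds.lean`), whose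
boundary layer (`OneArmPivotalLayer.lean`) bounds the two closed arms near `∂Λ_N` at `p > 1/2` by
their critical probability. But the boundary layer of `OneArmPivotalLayerSub.lean` already treats
BOTH sides of `1/2` with the mixed (one open, one closed) half-plane pair, i.e. with Werner's
near-critical bound `Werner2009_halfPlane_twoArm` alone (`oneArmPivotalSum_le_twoSided`: Werner's (C)
`Σ_v P_t(v pivotal for 0 ↔ ∂Λ_N) ≤ C N² π̂_t(r₀, N) P_t(0 ↔ ∂Λ_N)` for `|t - 1/2| < δ`, `t ≠ 1/2`,
`4N ≤ L_ε(t)`). This file runs the super-critical integration on that two-sided estimate as well: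

* `oneArm_super_of_para_pivotal_bound_div` — the super-critical half of Thm. 27 from the merged
  pivotal estimate `Σ_v P_t(v pivotal) ≤ K · (Σ_x P_t(x pivotal for H(N))) · P_t(0 ↔ ∂Λ_N)` assumed
  only for `t ∈ (1/2, 1/2 + δ)`, `n₁ ≤ N`, `C N ≤ L_ε(t)`: integrate Werner's potential
  `h_t(N') = P_t(H(N'))`, `H(N') = LR(2N', N')`, from `1/2` to `p` at `N' = ⌊N/4^C⌋`
  (`real_triOneArm_le_exp_mul_of_pivotal`), then `P_p(0 ↔ ∂Λ_N) ≤ P_p(0 ↔ ∂Λ_{N'})` and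
  `π₁(N') ≤ c^{-C} π₁(N)` (critical extendability, `real_triOneArm_extend_iter` at `t = 1/2`) — the
  mirror image of `oneArm_sub_of_para_pivotal_bound_div`;
* `oneArm_super_para_pivotal_bound_of_lower`, `oneArm_sub_para_pivotal_bound_of_lower` — the merged
  estimate on each side of `1/2` from (C) two-sided and the LOWER half of Werner's Lemma 6.2
  (`c N² π̂_t(r₀, N) ≤ Σ_x P_t(x pivotal for H(N))`, `1/2 ≤ t < 1/2 + δ`, `N ≤ L(t, ε)`), both as
  fact-free `∀∃` hypotheses; on the sub-critical side (A) is used at the dual parameter `1 - t` with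
  `π̂_{1-t} = π̂_t` (`fourArmProbAt_symm`), the potential being the easy-way crossing `LR(N, 2N)` whose
  pivotal count at `t` is `paraPivotalSum (1 - t) N` (`OneArmPivotalLayerSub.lean`);
* `Nolin2008_thm27_oneArm_of_twoSided_of_lower` — **Thm. 27 (`j = 1`) from (C) two-sided and
  (A, lower bound)**, by `Nolin2008_thm27_oneArm_of_halves`;
* `Nolin2008_thm27_oneArm_of_facts4` — **Thm. 27 (`j = 1`) from the FOUR named facts
  `Werner2009_fourArm_quasiMult` (Werner 2009, Cor. 6.2), `Werner2009_fourArm_lowerBound` (§3),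
  `Werner2009_halfPlane_twoArm` (§3 ¶1) and `Werner2009_pivotal_lowerBound` (proof of Lemma 6.2)**:
  (C) two-sided is `oneArmPivotalSum_le_twoSided`, (A, lower) is `paraPivotalSum_lower_of_fact`.
  The discharge of `Nolin2008_thm27_oneArm` is this theorem applied to the four `_holds`, once they
  exist; `Nolin2008_halfPlane_twoArm` is no longer a leaf.

## References

* P. Nolin, Near-critical percolation in two dimensions, *Electron. J. Probab.* 13 (2008)
  1562–1623, §6.1–6.2, Thm. 27 and its proof, Case 1 (arXiv 0711.4948: Thm. 26, pp. 18–22)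
  [Nolin2008].
* W. Werner, *Lectures on two-dimensional critical percolation*, IAS/Park City Math. Ser. 16
  (2009), Lecture 6, §3, Cor. 6.2, Lemma 6.2 and §5 ("Using differential inequalities for the
  one-arm event") [WernerPCMI2009].
* H. Kesten, Scaling relations for 2D-percolation, *Comm. Math. Phys.* 109 (1987) 109–156
  [KestenScalingCMP1987].

Tree: `oneArmPivotalSum_le_twoSided`, `oneArm_sub_of_para_pivotal_bound_div`
(`OneArmPivotalLayerSub.lean`), `paraPivotalSum_lower_of_fact` (`ParaPivotalSumBounds.lean`),
`real_triOneArm_le_exp_mul_of_pivotal`, `exists_pos_le_critOneArmProb`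
(`WernerPivotalEstimatesProofs.lean`), `real_triOneArm_extend_iter`, `le_four_pow_self`,
`charLength_le_charLength_of_half_lt`, `Nolin2008_thm27_oneArm_of_halves`
(`NearCriticalScalingOneArmProofs.lean`), `fourArmProbAt_symm`, `symm_mem_of_lt_half`
(`NearCriticalFourArmFactsSymm.lean`), `charLength_le_charLengthW`, `charLengthW_symm`
(`WernerCorrelationLength(Proofs).lean`), `triOneArm_anti` (`NearCriticalCorrelationLength.lean`).
-/

noncomputable section

open MeasureTheory Set Finset Real
open scoped unitInterval

namespace Literature.Probability.Percolation

open LatticeModels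

/-! ### The super-critical half from the pivotal estimate along Werner's potential at radii `≤ L_ε / C` -/

/-- **The super-critical half of Nolin's Thm. 27 (`j = 1`) from the pivotal estimate along
`h_t(N) = P_t(H(N))` at radii `≤ L_ε / C`** (Werner 2009, Lecture 6, §5: from
`|d/dp log P_p(0 ↔ ∂Λ_n)| ≤ c n² π̂_p(n) ≤ c' d/dp h_p(n)` "It follows that
`P_p(0 ↔ ∂Λ_n) ≍ P_{1/2}(0 ↔ ∂Λ_n)` for `n ≤ L(p)`"; Nolin 2008, §6.2, proof of Thm. 27, step 1
"First simplifications" and Case 1). If for small `ε` there are `n₁`, `δ > 0`, `K` with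
`Σ_{v ∈ Λ_N} P_t(v pivotal for 0 ↔ ∂Λ_N) ≤ K · (Σ_{x ∈ R(2N,N)} P_t(x pivotal for H(N))) · P_t(0 ↔ ∂Λ_N)`
for `t ∈ (1/2, 1/2 + δ)`, `n₁ ≤ N`, `C N ≤ L_ε(t)` (any fixed `C : ℕ`), then
`P_p(0 ↔ ∂Λ_N) ≤ C' π₁(N)` for `p ∈ (1/2, 1/2 + δ')`, `N ≤ L_ε(p)`: for large `N` the radius
`N' = ⌊N/4^C⌋` has `C N' ≤ N ≤ L_ε(p) ≤ L_ε(t)` along `t ∈ (1/2, p]`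
(`charLength_le_charLength_of_half_lt`), so the integration from `1/2` to `p`
(`real_triOneArm_le_exp_mul_of_pivotal`) gives `P_p(0 ↔ ∂Λ_{N'}) ≤ e^K π₁(N')`; then
`P_p(0 ↔ ∂Λ_N) ≤ P_p(0 ↔ ∂Λ_{N'})` (`triOneArm_anti`) and `c^C π₁(N') ≤ π₁(N)`
(`real_triOneArm_extend_iter` at `t = 1/2`); small radii by `P_p ≤ 1 ≤ π₁(N) / min_{N < n₂} π₁`
(`exists_pos_le_critOneArmProb`). [cite: WernerPCMI2009, Lecture 6, §5 ("Using differential inequalities for the one-arm event")] [cite: Nolin2008, §6.2, proof of Thm. 27, step 1 and Case 1 (arXiv 0711.4948: Thm. 26)] -/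
theorem oneArm_super_of_para_pivotal_bound_div (C : ℕ)
    (h : ∃ ε₁ > (0 : ℝ), ∀ ⦃ε : ℝ⦄, 0 < ε → ε < ε₁ → ∃ n₁ : ℕ, ∃ δ > (0 : ℝ), ∃ K : ℝ,
      ∀ t : unitInterval, 1 / 2 < (t : ℝ) → (t : ℝ) < 1 / 2 + δ →
        ∀ N : ℕ, n₁ ≤ N → C * N ≤ charLength ε t →
          oneArmPivotalSum t N ≤
            K * paraPivotalSum t N * (triSitePercolation t).real (triOneArm N)) :
    ∃ ε₁ > (0 : ℝ), ∀ ⦃ε : ℝ⦄, 0 < ε → ε < ε₁ → ∃ δ > (0 : ℝ), ∃ C : ℝ,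
      ∀ p : unitInterval, 1 / 2 < (p : ℝ) → (p : ℝ) < 1 / 2 + δ → ∀ N ≤ charLength ε p,
        (triSitePercolation p).real (triOneArm N) ≤ C * critOneArmProb N := by
  obtain ⟨ε₁, hε₁, h⟩ := h
  refine ⟨min ε₁ (1 / 2), lt_min hε₁ (by norm_num), fun ε hε hεlt => ?_⟩
  have hε₁' : ε < ε₁ := hεlt.trans_le (min_le_left _ _)
  have hε2 : ε < 1 / 2 := hεlt.trans_le (min_le_right _ _)
  obtain ⟨n₁, δ, hδ, K, hb⟩ := h hε hε₁'
  obtain ⟨cE, hcE, hE⟩ := real_triOneArm_extend_iter hε hε2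
  set j : ℕ := C with hj
  have hCj : C ≤ 4 ^ j := le_four_pow_self C
  have h4j : 1 ≤ 4 ^ j := Nat.one_le_pow _ _ (by norm_num)
  set n₂ : ℕ := max n₁ 8000 * 4 ^ j with hn₂
  obtain ⟨m, hm, hmle⟩ := exists_pos_le_critOneArmProb n₂
  set K' : ℝ := max K 0 with hK'
  have hK'0 : 0 ≤ K' := le_max_right _ _
  have hcEj : 0 < cE ^ j := pow_pos hcE _
  refine ⟨min δ (1 / 4), lt_min hδ (by norm_num), max (Real.exp K' / cE ^ j) (1 / m),
    fun p hp1 hp2 N hN => ?_⟩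
  have hπ0 : 0 ≤ critOneArmProb N := measureReal_nonneg
  have hP1 : (triSitePercolation p).real (triOneArm N) ≤ 1 := measureReal_le_one
  have hpδ : (p : ℝ) < 1 / 2 + δ := by
    have := min_le_left δ (1 / 4); linarith
  rcases lt_or_ge N n₂ with hNlt | hNge
  · -- small radii: `P_p ≤ 1 ≤ π₁(N) / m`
    have hmN : m ≤ critOneArmProb N := hmle N hNlt
    calc (triSitePercolation p).real (triOneArm N) ≤ 1 := hP1
      _ ≤ 1 / m * critOneArmProb N := by
          rw [div_mul_eq_mul_div, one_mul, le_div_iff₀ hm, one_mul]; exact hmN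
      _ ≤ max (Real.exp K' / cE ^ j) (1 / m) * critOneArmProb N :=
          mul_le_mul_of_nonneg_right (le_max_right _ _) hπ0
  · -- large radii: integration at `N' = N / 4^C` from `1/2` to `p`, then comparison of radii
    set N' : ℕ := N / 4 ^ j with hN'
    have hN'ge : max n₁ 8000 ≤ N' := (Nat.le_div_iff_mul_le (by positivity)).2 hNge
    have hN'n₁ : n₁ ≤ N' := le_trans (le_max_left _ _) hN'ge
    have hN'1 : 1 ≤ N' := le_trans (by omega) (le_trans (le_max_right _ _) hN'ge)
    have hCN' : C * N' ≤ N :=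
      calc C * N' ≤ 4 ^ j * N' := Nat.mul_le_mul_right _ hCj
        _ ≤ N := Nat.mul_div_le N (4 ^ j)
    have hN'N : N' ≤ N := Nat.div_le_self _ _
    have hp1' : (p : ℝ) < 1 := by
      have := min_le_right δ (1 / 4); linarith
    have hpiv : ∀ t : unitInterval, 1 / 2 < (t : ℝ) → t < p →
        oneArmPivotalSum t N' ≤
          K' * paraPivotalSum t N' * (triSitePercolation t).real (triOneArm N') := by
      intro t ht1 ht2
      have ht2' : (t : ℝ) < p := Subtype.coe_lt_coe.2 ht2
      have hNt : C * N' ≤ charLength ε t :=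
        hCN'.trans (hN.trans (charLength_le_charLength_of_half_lt hε ht1 ht2.le))
      have h1 := hb t ht1 (by linarith) N' hN'n₁ hNt
      have hnn : 0 ≤ paraPivotalSum t N' * (triSitePercolation t).real (triOneArm N') :=
        mul_nonneg (paraPivotalSum_nonneg _ N') measureReal_nonneg
      calc oneArmPivotalSum t N'
          ≤ K * paraPivotalSum t N' * (triSitePercolation t).real (triOneArm N') := h1
        _ = K * (paraPivotalSum t N' * (triSitePercolation t).real (triOneArm N')) :=
            mul_assoc _ _ _
        _ ≤ K' * (paraPivotalSum t N' * (triSitePercolation t).real (triOneArm N')) :=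
            mul_le_mul_of_nonneg_right (le_max_left _ _) hnn
        _ = K' * paraPivotalSum t N' * (triSitePercolation t).real (triOneArm N') :=
            (mul_assoc _ _ _).symm
    have hG := real_triOneArm_le_exp_mul_of_pivotal hp1 hp1' hK'0 hpiv
    -- critical extendability: `cE^j π₁(N') ≤ π₁(N)` (no length restriction at `t = 1/2`)
    have hext := hE half j N (le_trans (Nat.mul_le_mul_right _ (le_max_right _ _)) hNge)
      (fun hlt => absurd hlt (by rw [coe_half]; exact lt_irrefl _))
    -- the one-arm event is non-increasing in the radius
    have hanti : (triSitePercolation p).real (triOneArm N) ≤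
        (triSitePercolation p).real (triOneArm N') :=
      measureReal_mono (triOneArm_anti hN'1 hN'N) (measure_ne_top _ _)
    calc (triSitePercolation p).real (triOneArm N)
        ≤ (triSitePercolation p).real (triOneArm N') := hanti
      _ ≤ Real.exp K' * critOneArmProb N' := hG
      _ ≤ Real.exp K' * (critOneArmProb N / cE ^ j) := by
          apply mul_le_mul_of_nonneg_left _ (Real.exp_pos _).le
          rw [le_div_iff₀ hcEj, mul_comm]
          exact hext
      _ = Real.exp K' / cE ^ j * critOneArmProb N := by ring
      _ ≤ max (Real.exp K' / cE ^ j) (1 / m) * critOneArmProb N :=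
          mul_le_mul_of_nonneg_right (le_max_left _ _) hπ0

/-! ### The merged pivotal estimate on each side of `1/2` from (C) two-sided and (A, lower bound) -/

/-- **Super-critical side: (C) with the lower bound of Lemma 6.2** (Werner 2009, Lecture 6, §5 with
Lemma 6.2: `Σ_x P_p(x pivotal for 0 ↔ ∂Λ_n) ≤ c n² π̂_p(n) P_p(0 ↔ ∂Λ_n)` and
`c' n² π̂_p(n) ≤ d/dp h_p(n)`). From (C) in the two-sided format of `oneArmPivotalSum_le_twoSided` and
the lower half of Lemma 6.2 in the format of `paraPivotalSum_lower_of_fact` (at a common large inner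
radius `r₀`): for small `ε` there are `n₁`, `δ > 0`, `K` with
`Σ_{v ∈ Λ_N} P_t(v pivotal for 0 ↔ ∂Λ_N) ≤ K · paraPivotalSum t N · P_t(0 ↔ ∂Λ_N)` for
`t ∈ (1/2, 1/2 + δ)`, `n₁ ≤ N`, `4N ≤ L_ε(t)` (there `N ≤ L_ε(t) ≤ L(t, ε)`,
`charLength_le_charLengthW`). [cite: WernerPCMI2009, Lecture 6, §5 with Lemma 6.2 (lower bound)] [cite: Nolin2008, §6.2, proof of Thm. 27, Case 1 (arXiv 0711.4948: Thm. 26)] -/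
theorem oneArm_super_para_pivotal_bound_of_lower
    (hC2 : ∃ ε₁ > (0 : ℝ), ∀ ⦃ε : ℝ⦄, 0 < ε → ε < ε₁ →
      ∃ r₁ : ℕ, ∀ r₀ ≥ r₁, ∃ n₁ : ℕ, ∃ δ > (0 : ℝ), ∃ C : ℝ,
        ∀ t : unitInterval, |(t : ℝ) - 1 / 2| < δ → (t : ℝ) ≠ 1 / 2 →
          ∀ N : ℕ, n₁ ≤ N → 4 * N ≤ charLength ε t →
            oneArmPivotalSum t N ≤
              C * ((N : ℝ) ^ 2 * fourArmProbAt t r₀ N) * (triSitePercolation t).real (triOneArm N))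
    (hA : ∃ ε₁ > (0 : ℝ), ∀ ⦃ε : ℝ⦄, 0 < ε → ε < ε₁ →
      ∃ r₁ : ℕ, ∀ r₀ ≥ r₁, ∃ n₁ : ℕ, ∃ δ > (0 : ℝ), ∃ c > (0 : ℝ),
        ∀ t : unitInterval, 1 / 2 ≤ (t : ℝ) → (t : ℝ) < 1 / 2 + δ →
          ∀ N : ℕ, n₁ ≤ N → (1 / 2 < (t : ℝ) → N ≤ charLengthW ε t) →
            c * ((N : ℝ) ^ 2 * fourArmProbAt t r₀ N) ≤ paraPivotalSum t N) :
    ∃ ε₁ > (0 : ℝ), ∀ ⦃ε : ℝ⦄, 0 < ε → ε < ε₁ → ∃ n₁ : ℕ, ∃ δ > (0 : ℝ), ∃ K : ℝ,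
      ∀ t : unitInterval, 1 / 2 < (t : ℝ) → (t : ℝ) < 1 / 2 + δ →
        ∀ N : ℕ, n₁ ≤ N → 4 * N ≤ charLength ε t →
          oneArmPivotalSum t N ≤
            K * paraPivotalSum t N * (triSitePercolation t).real (triOneArm N) := by
  obtain ⟨εC, hεC, HC⟩ := hC2
  obtain ⟨εA, hεA, HA⟩ := hA
  refine ⟨min εC εA, lt_min hεC hεA, fun ε hε hε₁ => ?_⟩
  have hεC' : ε < εC := hε₁.trans_le (min_le_left _ _)
  have hεA' : ε < εA := hε₁.trans_le (min_le_right _ _)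
  obtain ⟨rC, HC⟩ := HC hε hεC'
  obtain ⟨rA, HA⟩ := HA hε hεA'
  set r₀ : ℕ := max rC rA with hr₀
  obtain ⟨nC, δC, hδC, C, hC⟩ := HC r₀ (le_max_left _ _)
  obtain ⟨nA, δA, hδA, c, hc, hAb⟩ := HA r₀ (le_max_right _ _)
  set C' : ℝ := max C 0 with hC'
  refine ⟨max nC nA, min δC δA, lt_min hδC hδA, C' / c, fun t ht1 ht2 N hN hNL => ?_⟩
  have htC : |(t : ℝ) - 1 / 2| < δC := by
    rw [abs_sub_lt_iff]; constructor <;> linarith [min_le_left δC δA]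
  have htne : (t : ℝ) ≠ 1 / 2 := ht1.ne'
  have hNC : nC ≤ N := (le_max_left _ _).trans hN
  have hNA : nA ≤ N := (le_max_right _ _).trans hN
  have hNLε : N ≤ charLength ε t := le_trans (by omega) hNL
  have hNW : N ≤ charLengthW ε t := hNLε.trans (charLength_le_charLengthW hε htne)
  -- (C) at `t`
  have hsum := hC t htC htne N hNC hNL
  -- Lemma 6.2 (lower bound) at `t`
  have hlow := hAb t ht1.le (by linarith [min_le_right δC δA]) N hNA fun _ => hNW
  -- `Σ ≤ C' N² π̂_t P ≤ (C'/c) · para t · P`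
  have hA0 : 0 ≤ (triSitePercolation t).real (triOneArm N) := measureReal_nonneg
  have hN2π : 0 ≤ (N : ℝ) ^ 2 * fourArmProbAt t r₀ N := by
    have := fourArmProbAt_nonneg t r₀ N; positivity
  have hC'0 : 0 ≤ C' := le_max_right _ _
  calc oneArmPivotalSum t N
      ≤ C * ((N : ℝ) ^ 2 * fourArmProbAt t r₀ N) * (triSitePercolation t).real (triOneArm N) := hsum
    _ ≤ C' * ((N : ℝ) ^ 2 * fourArmProbAt t r₀ N) * (triSitePercolation t).real (triOneArm N) :=
        mul_le_mul_of_nonneg_right (mul_le_mul_of_nonneg_right (le_max_left _ _) hN2π) hA0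
    _ ≤ C' / c * paraPivotalSum t N * (triSitePercolation t).real (triOneArm N) := by
        apply mul_le_mul_of_nonneg_right _ hA0
        rw [div_mul_eq_mul_div, le_div_iff₀ hc]
        calc C' * ((N : ℝ) ^ 2 * fourArmProbAt t r₀ N) * c
            = C' * (c * ((N : ℝ) ^ 2 * fourArmProbAt t r₀ N)) := by ring
          _ ≤ C' * paraPivotalSum t N := mul_le_mul_of_nonneg_left hlow hC'0

/-- **Sub-critical side: (C) with the lower bound of Lemma 6.2 at the dual parameter** (Nolin 2008,
§6.2, proof of Thm. 27, Case 1, "uniformly in `P̂` between `P_p` and `P_{1-p}`"; Werner 2009,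
Lecture 6, §5 with Lemma 6.2). As `oneArm_para_pivotal_bound_of_facts`, with (C) two-sided and the
lower half of Lemma 6.2 as `∀∃` hypotheses: for `t ∈ (1/2 - δ, 1/2)` the dual parameter `1 - t`
lies in `(1/2, 1/2 + δ)` (`symm_mem_of_lt_half`), `L(1 - t, ε) = L(t, ε) ≥ L_ε(t)`
(`charLengthW_symm`, `charLength_le_charLengthW`) and `π̂_{1-t} = π̂_t` (`fourArmProbAt_symm`), so
`Σ_v P_t(v pivotal) ≤ C N² π̂_t(r₀, N) P_t(0 ↔ ∂Λ_N) ≤ (C/c) · paraPivotalSum (1 - t) N · P_t(0 ↔ ∂Λ_N)`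
for `n₁ ≤ N`, `4N ≤ L_ε(t)`. [cite: Nolin2008, §6.2, proof of Thm. 27, Case 1 (arXiv 0711.4948: Thm. 26)] [cite: WernerPCMI2009, Lecture 6, §5 with Lemma 6.2 (lower bound)] -/
theorem oneArm_sub_para_pivotal_bound_of_lower
    (hC2 : ∃ ε₁ > (0 : ℝ), ∀ ⦃ε : ℝ⦄, 0 < ε → ε < ε₁ →
      ∃ r₁ : ℕ, ∀ r₀ ≥ r₁, ∃ n₁ : ℕ, ∃ δ > (0 : ℝ), ∃ C : ℝ,
        ∀ t : unitInterval, |(t : ℝ) - 1 / 2| < δ → (t : ℝ) ≠ 1 / 2 →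
          ∀ N : ℕ, n₁ ≤ N → 4 * N ≤ charLength ε t →
            oneArmPivotalSum t N ≤
              C * ((N : ℝ) ^ 2 * fourArmProbAt t r₀ N) * (triSitePercolation t).real (triOneArm N))
    (hA : ∃ ε₁ > (0 : ℝ), ∀ ⦃ε : ℝ⦄, 0 < ε → ε < ε₁ →
      ∃ r₁ : ℕ, ∀ r₀ ≥ r₁, ∃ n₁ : ℕ, ∃ δ > (0 : ℝ), ∃ c > (0 : ℝ),
        ∀ t : unitInterval, 1 / 2 ≤ (t : ℝ) → (t : ℝ) < 1 / 2 + δ →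
          ∀ N : ℕ, n₁ ≤ N → (1 / 2 < (t : ℝ) → N ≤ charLengthW ε t) →
            c * ((N : ℝ) ^ 2 * fourArmProbAt t r₀ N) ≤ paraPivotalSum t N) :
    ∃ ε₁ > (0 : ℝ), ∀ ⦃ε : ℝ⦄, 0 < ε → ε < ε₁ → ∃ n₁ : ℕ, ∃ δ > (0 : ℝ), ∃ K : ℝ,
      ∀ t : unitInterval, 1 / 2 - δ < (t : ℝ) → (t : ℝ) < 1 / 2 →
        ∀ N : ℕ, n₁ ≤ N → 4 * N ≤ charLength ε t →
          oneArmPivotalSum t N ≤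
            K * paraPivotalSum (σ t) N * (triSitePercolation t).real (triOneArm N) := by
  obtain ⟨εC, hεC, HC⟩ := hC2
  obtain ⟨εA, hεA, HA⟩ := hA
  refine ⟨min εC εA, lt_min hεC hεA, fun ε hε hε₁ => ?_⟩
  have hεC' : ε < εC := hε₁.trans_le (min_le_left _ _)
  have hεA' : ε < εA := hε₁.trans_le (min_le_right _ _)
  obtain ⟨rC, HC⟩ := HC hε hεC'
  obtain ⟨rA, HA⟩ := HA hε hεA'
  set r₀ : ℕ := max rC rA with hr₀
  obtain ⟨nC, δC, hδC, C, hC⟩ := HC r₀ (le_max_left _ _)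
  obtain ⟨nA, δA, hδA, c, hc, hAb⟩ := HA r₀ (le_max_right _ _)
  set C' : ℝ := max C 0 with hC'
  refine ⟨max nC nA, min δC δA, lt_min hδC hδA, C' / c, fun t ht1 ht2 N hN hNL => ?_⟩
  have htC : |(t : ℝ) - 1 / 2| < δC := by
    rw [abs_sub_lt_iff]; constructor <;> linarith [min_le_left δC δA]
  have htne : (t : ℝ) ≠ 1 / 2 := ht2.ne
  have hNC : nC ≤ N := (le_max_left _ _).trans hN
  have hNA : nA ≤ N := (le_max_right _ _).trans hN
  have hNLε : N ≤ charLength ε t := le_trans (by omega) hNL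
  have hNW : N ≤ charLengthW ε t := hNLε.trans (charLength_le_charLengthW hε htne)
  -- (C) at `t`
  have hsum := hC t htC htne N hNC hNL
  -- Lemma 6.2 (lower bound) at `1 - t`
  obtain ⟨hs1, hs2⟩ := symm_mem_of_lt_half (δ := δA) ht2 (by linarith [min_le_right δC δA])
  have hlow := hAb (σ t) hs1.le hs2 N hNA fun _ => by rw [charLengthW_symm]; exact hNW
  rw [fourArmProbAt_symm] at hlow
  -- `Σ ≤ C' N² π̂_t P ≤ (C'/c) · para (1-t) · P`
  have hA0 : 0 ≤ (triSitePercolation t).real (triOneArm N) := measureReal_nonneg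
  have hN2π : 0 ≤ (N : ℝ) ^ 2 * fourArmProbAt t r₀ N := by
    have := fourArmProbAt_nonneg t r₀ N; positivity
  have hC'0 : 0 ≤ C' := le_max_right _ _
  calc oneArmPivotalSum t N
      ≤ C * ((N : ℝ) ^ 2 * fourArmProbAt t r₀ N) * (triSitePercolation t).real (triOneArm N) := hsum
    _ ≤ C' * ((N : ℝ) ^ 2 * fourArmProbAt t r₀ N) * (triSitePercolation t).real (triOneArm N) :=
        mul_le_mul_of_nonneg_right (mul_le_mul_of_nonneg_right (le_max_left _ _) hN2π) hA0
    _ ≤ C' / c * paraPivotalSum (σ t) N * (triSitePercolation t).real (triOneArm N) := by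
        apply mul_le_mul_of_nonneg_right _ hA0
        rw [div_mul_eq_mul_div, le_div_iff₀ hc]
        calc C' * ((N : ℝ) ^ 2 * fourArmProbAt t r₀ N) * c
            = C' * (c * ((N : ℝ) ^ 2 * fourArmProbAt t r₀ N)) := by ring
          _ ≤ C' * paraPivotalSum (σ t) N := mul_le_mul_of_nonneg_left hlow hC'0

/-! ### Nolin's Thm. 27 (`j = 1`) from (C) two-sided and (A, lower bound); from four named facts -/

/-- **Nolin's Thm. 27 for one arm from Werner's (C) on both sides of `1/2` and the lower bound of
Lemma 6.2** (Nolin 2008, §6.1–6.2, Thm. 27 [arXiv 0711.4948: Thm. 26], `j = 1`; Werner 2009,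
Lecture 6, §5 with Lemma 6.2): the super-critical half by `oneArm_super_of_para_pivotal_bound_div 4`
with `oneArm_super_para_pivotal_bound_of_lower`, the sub-critical half by
`oneArm_sub_of_para_pivotal_bound_div 4` with `oneArm_sub_para_pivotal_bound_of_lower`, assembled by
`Nolin2008_thm27_oneArm_of_halves` (the two remaining inequalities being monotonicity in `p`). Both
hypotheses are fact-free `∀∃` statements: (C) in the format of `oneArmPivotalSum_le_twoSided`, the
lower half of (A) in the format of `paraPivotalSum_lower_of_fact`. [cite: Nolin2008, §6.1–6.2, Thm. 27 and its proof, Case 1 (arXiv 0711.4948: Thm. 26), case j = 1] [cite: WernerPCMI2009, Lecture 6, §5 with Lemma 6.2 (lower bound)] -/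
theorem Nolin2008_thm27_oneArm_of_twoSided_of_lower
    (hC2 : ∃ ε₁ > (0 : ℝ), ∀ ⦃ε : ℝ⦄, 0 < ε → ε < ε₁ →
      ∃ r₁ : ℕ, ∀ r₀ ≥ r₁, ∃ n₁ : ℕ, ∃ δ > (0 : ℝ), ∃ C : ℝ,
        ∀ t : unitInterval, |(t : ℝ) - 1 / 2| < δ → (t : ℝ) ≠ 1 / 2 →
          ∀ N : ℕ, n₁ ≤ N → 4 * N ≤ charLength ε t →
            oneArmPivotalSum t N ≤
              C * ((N : ℝ) ^ 2 * fourArmProbAt t r₀ N) * (triSitePercolation t).real (triOneArm N))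
    (hA : ∃ ε₁ > (0 : ℝ), ∀ ⦃ε : ℝ⦄, 0 < ε → ε < ε₁ →
      ∃ r₁ : ℕ, ∀ r₀ ≥ r₁, ∃ n₁ : ℕ, ∃ δ > (0 : ℝ), ∃ c > (0 : ℝ),
        ∀ t : unitInterval, 1 / 2 ≤ (t : ℝ) → (t : ℝ) < 1 / 2 + δ →
          ∀ N : ℕ, n₁ ≤ N → (1 / 2 < (t : ℝ) → N ≤ charLengthW ε t) →
            c * ((N : ℝ) ^ 2 * fourArmProbAt t r₀ N) ≤ paraPivotalSum t N) :
    Nolin2008_thm27_oneArm :=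
  Nolin2008_thm27_oneArm_of_halves
    (oneArm_super_of_para_pivotal_bound_div 4 (oneArm_super_para_pivotal_bound_of_lower hC2 hA))
    (oneArm_sub_of_para_pivotal_bound_div 4 (oneArm_sub_para_pivotal_bound_of_lower hC2 hA))

/-- **Nolin's Thm. 27 for one arm from FOUR named facts** (Nolin 2008, §6.1, Thm. 27
[arXiv 0711.4948: Thm. 26], `j = 1`: `c π₁(N) ≤ P_p(0 ↔ ∂Λ_N) ≤ C π₁(N)` for `p ≠ 1/2` near `1/2`,
`N ≤ L_ε(p)`, every `ε ∈ (0, 1/2)`): `Werner2009_fourArm_quasiMult` (Werner 2009, Cor. 6.2),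
`Werner2009_fourArm_lowerBound` (§3), `Werner2009_halfPlane_twoArm` (§3 ¶1, the mixed half-plane
pair below `L(p)`) and `Werner2009_pivotal_lowerBound` (proof of Lemma 6.2, lower bound) — the leaf
`Nolin2008_halfPlane_twoArm` of `Nolin2008_thm27_oneArm_of_facts` (used there for two CLOSED arms near
`∂Λ_N` at `p > 1/2`) is not needed: (C) is `oneArmPivotalSum_le_twoSided` on both sides of `1/2`
(boundary layer by the mixed pair), (A, lower) is `paraPivotalSum_lower_of_fact`. Everything else —
RSW below `L_ε` on both sides, circuits, quasi-multiplicativity and extendability of one arm, the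
geometry of pivotal sites, the colour-exchange symmetries, Russo's formula, the integration and the
summations — is proved in the tree. The discharge `Nolin2008_thm27_oneArm_holds` is this theorem
applied to the four `_holds`. [cite: Nolin2008, §6.1–6.2, Thm. 27 and its proof (arXiv 0711.4948: Thm. 26), case j = 1] [cite: WernerPCMI2009, Lecture 6, §3–§5 (Cor. 6.2, Lemma 6.2, "Using differential inequalities for the one-arm event")] -/
theorem Nolin2008_thm27_oneArm_of_facts4 (hQM : Werner2009_fourArm_quasiMult)
    (hLB : Werner2009_fourArm_lowerBound) (hHPW : Werner2009_halfPlane_twoArm)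
    (hP : Werner2009_pivotal_lowerBound) : Nolin2008_thm27_oneArm :=
  Nolin2008_thm27_oneArm_of_twoSided_of_lower (oneArmPivotalSum_le_twoSided hQM hLB hHPW)
    (paraPivotalSum_lower_of_fact hP)

end Literature.Probability.Percolation
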